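import Summits.CriticalPhenomena.PercolationContinuityZ3.Theorems.PercNearOneGluingNoHeavyLowerTailKnQuestion8CoefficientwiseCoreClassKernelMixPathTransfer
import Summits.CriticalPhenomena.PercolationContinuityZ3.Theorems.PercNearOneGluingNoHeavyLowerTailKnQuestion8CoefficientwiseCoreClassDomBundle
import HarnessLib

/-!
# THEOREM SKEW-C / SKEW-Θ: the skew piece of the hat 2-sum from a proper map and the path-contact transfer

Support file (`--supports stmt-CriticalPhenomena-4575`, closed), prover `prim-cplus-coupling` (gen 37).  No definitions, no notations, no named facts,
no sorries; standard axioms.  Memo `prim-cplus-coupling/A5-COUPLING-gen37.md` §2.  Uses `…KernelMixPathTransfer` (the contact cell) and the pocket-free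
involution `R_A` of `…CoreClassDomPocketFree` / `…CoreClassDomBundle` (the wall cell).

Setting: edge set `E`, roots `u` (red side) and `v` (blue side), observer `b`.  SKEW(E; u, v; b) — the `RB` class of the hat `a ~ u, v` glued onto `E`
(gen 36 memo §5.1), glue absorbed into the levels:
  `Σ_{ω ⊆ E} h(C_u ω ∪ C_b ω)k(…) + Σ_{ω : b ∉ C_u ω, v ∉ C_b(E∖ω)} (hᵃ(C_u ω) − hᵇ(C_b(E∖ω)))(kᵃ(C_u ω) − kᵇ(C_b(E∖ω))) ≥ 0`
(the KB-MIX-FULL wall `{b ∉ C_u ω, u ∉ C_b(E∖ω)}` of `(E; u, b)` with the blue condition moved from `u` to `v`).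
* `Coefficientwise.coreClass_skew_of_properDom_path` — **THEOREM SKEW-C**: a proper domination map of `(E; u, b)` plus a nonempty `u–b` edge set `W` that is
  blue whenever `u ∈ C_b(E∖ω) ∌ v` give SKEW(E; u, v; b): the cell `{u ∉ C_b(E∖ω)}` termwise by the map (images off `{b ∈ C_u}`), the contact cell
  `{u ∈ C_b(E∖ω)}` by `pathContact_transfer` with the increasing event `{v ∉ C_u(E∖η)}` (supply at `η ∪ W` and at the phantoms, inside `{b ∈ C_u}`).
* `Coefficientwise.coreClass_skew_of_deg_le_two_path` — **THEOREM SKEW-Θ**: internal degree `≤ 2` at every vertex other than `u, b` (so `R_A` is a proper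
  map) plus such a `W`: SKEW holds — every cycle through `u, b, v` with `W` the `u–b` arc avoiding `v`.  With THEOREM DR-Θ (`…KernelMixDoubleRootTheta`)
  and the hat split this is KB-MIX-FULL for the hat over every cycle, i.e. THEOREM A-ARM BRIDGES `W(0,0,s₃,s₄,s₅)` for all `s` (memo §3).
[cite: KozmaNitzan2024, Questions 8–9 (§5.5 p. 36) (context: the Question-8 pocket covariance programme)]
-/

namespace Summit.CriticalPhenomena.PercolationContinuityZ3.Theorems

open Finset Literature.Probability.Percolation
open scoped symmDiff

namespace Coefficientwise

variable {ι V : Type*}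

open Classical in
/-- **THEOREM SKEW-C (the skew piece of the hat from a proper map and a forced blue path).**  Edge set `E`, root `u`, second root `v`, observer `b`;
monotone `h, k`, monotone levels `0 ≤ hᵃ, hᵇ ≤ h`, `0 ≤ kᵃ, kᵇ ≤ k`.  Hypotheses: (i) a PROPER domination map `ψ` of `(E; u, b)` (on the wall
`{b ∉ C_u ω, b ∉ C_u(E∖ω)}`: `ψω ⊆ E`, `C_u ω ∪ C_b(E∖ω) ⊆ C_u(ψω) ∪ C_b(ψω)`, injective, `b ∉ C_u(ψω)`); (ii) a nonempty edge set `W ⊆ E` joining `u`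
to `b` (`b ∈ C_u(W)`) which is BLUE whenever `u` is blue-joined to `b` but `v` is not (`u ∈ C_b(E∖ω), v ∉ C_b(E∖ω) ⟹ W ∩ ω = ∅`; e.g. `E` a cycle through
`u, b, v` and `W` the `u–b` arc avoiding `v`).  Then SKEW(E; u, v; b) holds:
`0 ≤ Σ_{ω ⊆ E} h(C_u ω ∪ C_b ω)k(…) + Σ_{ω : b ∉ C_u ω, v ∉ C_b(E∖ω)} (hᵃ(C_u ω) − hᵇ(C_b(E∖ω)))(kᵃ(C_u ω) − kᵇ(C_b(E∖ω)))`.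
Proof: the cell `{u ∉ C_b(E∖ω)}` termwise by `ψ` (images off `{b ∈ C_u}`), the contact cell `{u ∈ C_b(E∖ω)}` by `pathContact_transfer` with
`𝒱 = {v ∉ C_u(E∖η)}` (supply at `η ∪ W` and at the phantoms, both inside `{b ∈ C_u}`, disjoint since `W ≠ ∅`).
[cite: KozmaNitzan2024, Questions 8–9 (§5.5 p. 36) (context)] -/
theorem coreClass_skew_of_properDom_path (ends : ι → Sym2 V) (E W : Finset ι) (u v b : V) (h k ha hb ka kb : Set V → ℝ)
    (hh : Monotone h) (hk : Monotone k) (mha : Monotone ha) (mhb : Monotone hb) (mka : Monotone ka) (mkb : Monotone kb)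
    (ha0 : ∀ X, 0 ≤ ha X) (hah : ∀ X, ha X ≤ h X) (hb0 : ∀ X, 0 ≤ hb X) (hbh : ∀ X, hb X ≤ h X)
    (ka0 : ∀ X, 0 ≤ ka X) (kak : ∀ X, ka X ≤ k X) (kb0 : ∀ X, 0 ≤ kb X) (kbk : ∀ X, kb X ≤ k X)
    (ψ : Finset ι → Finset ι)
    (hψE : ∀ ω, ω ⊆ E → b ∉ openCluster (ends '' (↑ω : Set ι)) u → b ∉ openCluster (ends '' (↑(E \ ω) : Set ι)) u → ψ ω ⊆ E)
    (hψcov : ∀ ω, ω ⊆ E → b ∉ openCluster (ends '' (↑ω : Set ι)) u → b ∉ openCluster (ends '' (↑(E \ ω) : Set ι)) u →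
      openCluster (ends '' (↑ω : Set ι)) u ∪ openCluster (ends '' (↑(E \ ω) : Set ι)) b ⊆
        openCluster (ends '' (↑(ψ ω) : Set ι)) u ∪ openCluster (ends '' (↑(ψ ω) : Set ι)) b)
    (hψinj : ∀ ω₁ ω₂, ω₁ ⊆ E → b ∉ openCluster (ends '' (↑ω₁ : Set ι)) u → b ∉ openCluster (ends '' (↑(E \ ω₁) : Set ι)) u →
      ω₂ ⊆ E → b ∉ openCluster (ends '' (↑ω₂ : Set ι)) u → b ∉ openCluster (ends '' (↑(E \ ω₂) : Set ι)) u → ψ ω₁ = ψ ω₂ → ω₁ = ω₂)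
    (hψprop : ∀ ω, ω ⊆ E → b ∉ openCluster (ends '' (↑ω : Set ι)) u → b ∉ openCluster (ends '' (↑(E \ ω) : Set ι)) u →
      b ∉ openCluster (ends '' (↑(ψ ω) : Set ι)) u)
    (hWE : W ⊆ E) (hWne : W.Nonempty) (hWub : b ∈ openCluster (ends '' (↑W : Set ι)) u)
    (hArc : ∀ ω, ω ⊆ E → u ∈ openCluster (ends '' (↑(E \ ω) : Set ι)) b → v ∉ openCluster (ends '' (↑(E \ ω) : Set ι)) b → Disjoint W ω) :
    0 ≤ (∑ ω ∈ E.powerset,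
        h (openCluster (ends '' (↑ω : Set ι)) u ∪ openCluster (ends '' (↑ω : Set ι)) b) *
          k (openCluster (ends '' (↑ω : Set ι)) u ∪ openCluster (ends '' (↑ω : Set ι)) b))
      + ∑ ω ∈ E.powerset.filter (fun ω : Finset ι => b ∉ openCluster (ends '' (↑ω : Set ι)) u ∧ v ∉ openCluster (ends '' (↑(E \ ω) : Set ι)) b),
        (ha (openCluster (ends '' (↑ω : Set ι)) u) - hb (openCluster (ends '' (↑(E \ ω) : Set ι)) b)) *
          (ka (openCluster (ends '' (↑ω : Set ι)) u) - kb (openCluster (ends '' (↑(E \ ω) : Set ι)) b)) := by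
  set C : Finset ι → V → Set V := fun ω x => openCluster (ends '' (↑ω : Set ι)) x with hC
  set S : Finset ι → Set V := fun ω => C ω u ∪ C ω b with hS
  change 0 ≤ (∑ ω ∈ E.powerset, h (S ω) * k (S ω))
    + ∑ ω ∈ E.powerset.filter (fun ω => b ∉ C ω u ∧ v ∉ C (E \ ω) b), (ha (C ω u) - hb (C (E \ ω) b)) * (ka (C ω u) - kb (C (E \ ω) b))
  have hCmono : ∀ {ω ω' : Finset ι} (x : V), ω ⊆ ω' → C ω x ⊆ C ω' x := fun x hle => openCluster_image_mono ends hle x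
  have hh0 : ∀ X, 0 ≤ h X := fun X => le_trans (ha0 X) (hah X)
  have hk0 : ∀ X, 0 ≤ k X := fun X => le_trans (ka0 X) (kak X)
  have hY0 : ∀ ω, 0 ≤ h (S ω) * k (S ω) := fun ω => mul_nonneg (hh0 _) (hk0 _)
  set Tm : Finset ι → ℝ := fun ω => (ha (C ω u) - hb (C (E \ ω) b)) * (ka (C ω u) - kb (C (E \ ω) b)) with hTm
  set D₁ : Finset ι → Prop := fun ω => (b ∉ C ω u ∧ v ∉ C (E \ ω) b) ∧ u ∉ C (E \ ω) b with hD₁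
  set D₂ : Finset ι → Prop := fun ω => (b ∉ C ω u ∧ v ∉ C (E \ ω) b) ∧ u ∈ C (E \ ω) b with hD₂
  -- the increasing event `v ∉ C_u(E∖η)` as an opaque predicate (so that all `if`s use the classical instances of `pathContact_transfer`)
  obtain ⟨𝒱, h𝒱⟩ : ∃ 𝒱 : Finset ι → Prop, 𝒱 = fun η => v ∉ C (E \ η) u := ⟨_, rfl⟩
  have hVdef : ∀ η, 𝒱 η ↔ v ∉ C (E \ η) u := fun η => by rw [h𝒱]
  have hVmono : ∀ ⦃s t : Finset ι⦄, s ⊆ t → 𝒱 s → 𝒱 t :=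
    fun s t hst hs => (hVdef t).mpr (fun hx => (hVdef s).mp hs (hCmono u (Finset.sdiff_subset_sdiff (le_refl E) hst) hx))
  -- (1) anti-sum = D₁ part + D₂ part
  have hsplit_anti : ∑ ω ∈ E.powerset.filter (fun ω => b ∉ C ω u ∧ v ∉ C (E \ ω) b), Tm ω
      = (∑ ω ∈ E.powerset, if D₁ ω then Tm ω else 0) + ∑ ω ∈ E.powerset, if D₂ ω then Tm ω else 0 := by
    rw [Finset.sum_filter, ← Finset.sum_add_distrib]
    refine Finset.sum_congr rfl fun ω _ => ?_
    by_cases h1 : b ∉ C ω u ∧ v ∉ C (E \ ω) b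
    · by_cases h2 : u ∈ C (E \ ω) b
      · rw [if_pos h1, if_neg (fun hx => hx.2 h2), if_pos ⟨h1, h2⟩, zero_add]
      · rw [if_pos h1, if_pos ⟨h1, h2⟩, if_neg (fun hx => h2 hx.2), add_zero]
    · rw [if_neg h1, if_neg (fun hx => h1 hx.1), if_neg (fun hx => h1 hx.1), add_zero]
  -- (2) the wall part D₁: termwise against the supply at ψ ω, images off {b ∈ C_u}
  have step : 0 ≤ ∑ ω ∈ E.powerset, ((if D₁ ω then Tm ω else 0) + (if D₁ ω then h (S (ψ ω)) * k (S (ψ ω)) else 0)) := by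
    refine Finset.sum_nonneg fun ω hω => ?_
    by_cases h1 : D₁ ω
    · rw [if_pos h1, if_pos h1]
      have hωE := Finset.mem_powerset.mp hω
      have hbB : b ∉ C (E \ ω) u := fun hx => h1.2 ((mem_openCluster_comm ends (E \ ω) u b).mp hx)
      have hcov := hψcov ω hωE h1.1.1 hbB
      have hPS : C ω u ⊆ S (ψ ω) := fun y hy => hcov (Or.inl hy)
      have hQS : C (E \ ω) b ⊆ S (ψ ω) := fun y hy => hcov (Or.inr hy)
      have := mul_add_sub_mul_sub_nonneg (A := h (S (ψ ω))) (B := k (S (ψ ω)))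
        (α := ha (C ω u)) (β := hb (C (E \ ω) b)) (γ := ka (C ω u)) (δ := kb (C (E \ ω) b))
        (ha0 _) (le_trans (hah _) (hh hPS)) (hb0 _) (le_trans (hbh _) (hh hQS))
        (ka0 _) (le_trans (kak _) (hk hPS)) (kb0 _) (le_trans (kbk _) (hk hQS))
      simp only [hTm]; linarith
    · rw [if_neg h1, if_neg h1]; linarith
  have lower : ∑ ω ∈ E.powerset, (if D₁ ω then h (S (ψ ω)) * k (S (ψ ω)) else 0)
      ≤ ∑ ω ∈ E.powerset, (if b ∉ C ω u then h (S ω) * k (S ω) else 0) := by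
    rw [← Finset.sum_filter, ← Finset.sum_filter]
    have hTmem : ∀ {ω}, ω ∈ E.powerset.filter (fun ω => D₁ ω) ↔ ω ⊆ E ∧ D₁ ω := fun {ω} => by
      rw [Finset.mem_filter, Finset.mem_powerset]
    have hbB : ∀ {ω}, D₁ ω → b ∉ C (E \ ω) u := fun {ω} h1 hx => h1.2 ((mem_openCluster_comm ends (E \ ω) u b).mp hx)
    have hinj : ∀ ω₁ ∈ E.powerset.filter (fun ω => D₁ ω), ∀ ω₂ ∈ E.powerset.filter (fun ω => D₁ ω), ψ ω₁ = ψ ω₂ → ω₁ = ω₂ := by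
      intro ω₁ h₁ ω₂ h₂ he
      obtain ⟨s1, t1⟩ := hTmem.mp h₁
      obtain ⟨s2, t2⟩ := hTmem.mp h₂
      exact hψinj ω₁ ω₂ s1 t1.1.1 (hbB t1) s2 t2.1.1 (hbB t2) he
    have e1 : ∑ ω ∈ E.powerset.filter (fun ω => D₁ ω), h (S (ψ ω)) * k (S (ψ ω))
        = ∑ ω' ∈ (E.powerset.filter (fun ω => D₁ ω)).image ψ, h (S ω') * k (S ω') :=
      (Finset.sum_image (f := fun ω' => h (S ω') * k (S ω')) hinj).symm
    rw [e1]
    refine Finset.sum_le_sum_of_subset_of_nonneg ?_ (fun ω _ _ => hY0 ω)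
    intro ω' hω'
    rw [Finset.mem_image] at hω'
    obtain ⟨ω, hω, rfl⟩ := hω'
    obtain ⟨s1, t1⟩ := hTmem.mp hω
    rw [Finset.mem_filter, Finset.mem_powerset]
    exact ⟨hψE ω s1 t1.1.1 (hbB t1), hψprop ω s1 t1.1.1 (hbB t1)⟩
  -- (3) the contact cell D₂ lives on the colourings of `E ∖ W` (W blue) and is the demand of the path-contact transfer
  have hD₂sub : ∀ ω, ω ⊆ E → D₂ ω → ω ⊆ E \ W := by
    intro ω hωE h2 i hi
    rw [Finset.mem_sdiff]
    refine ⟨hωE hi, fun hiW => ?_⟩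
    exact (Finset.disjoint_left.mp (hArc ω hωE h2.2 h2.1.2)) hiW hi
  have huB : ∀ η, η ⊆ E \ W → u ∈ C (E \ η) b := by
    intro η hη
    have hWsub : W ⊆ E \ η := by
      intro i hiW
      rw [Finset.mem_sdiff]
      exact ⟨hWE hiW, fun hiη => (Finset.mem_sdiff.mp (hη hiη)).2 hiW⟩
    exact (mem_openCluster_comm ends (E \ η) b u).mpr (hCmono u hWsub hWub)
  have hCbu : ∀ η, η ⊆ E \ W → C (E \ η) b = C (E \ η) u := by
    intro η hη
    ext y; constructor
    · intro hy; exact SimpleGraph.Reachable.trans (SimpleGraph.Reachable.symm (huB η hη)) hy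
    · intro hy; exact SimpleGraph.Reachable.trans (huB η hη) hy
  have hD₂sum : ∑ ω ∈ E.powerset, (if D₂ ω then Tm ω else 0)
      = ∑ η ∈ (E \ W).powerset, (if 𝒱 η ∧ b ∉ C η u then
          (ha (C η u) - hb (C (E \ η) u)) * (ka (C η u) - kb (C (E \ η) u)) else 0) := by
    have hsub : (E \ W).powerset ⊆ E.powerset := Finset.powerset_mono.mpr Finset.sdiff_subset
    rw [← Finset.sum_subset hsub (f := fun ω => if D₂ ω then Tm ω else 0) ?_]
    · refine Finset.sum_congr rfl fun η hη => ?_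
      have hη := Finset.mem_powerset.mp hη
      by_cases h2 : D₂ η
      · have h2' : 𝒱 η ∧ b ∉ C η u := ⟨(hVdef η).mpr (by rw [← hCbu η hη]; exact h2.1.2), h2.1.1⟩
        rw [if_pos h2, if_pos h2']
        simp only [hTm, hCbu η hη]
      · have h2' : ¬ (𝒱 η ∧ b ∉ C η u) := by
          intro hx; apply h2
          refine ⟨⟨hx.2, ?_⟩, huB η hη⟩
          rw [hCbu η hη]; exact (hVdef η).mp hx.1
        rw [if_neg h2, if_neg h2']
    · intro ω hω hωn
      have hωE := Finset.mem_powerset.mp hω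
      by_cases h2 : D₂ ω
      · exact absurd (Finset.mem_powerset.mpr (hD₂sub ω hωE h2)) hωn
      · rw [if_neg h2]
  have hcontact := pathContact_transfer ends E W hWE u b 𝒱 hVmono h k ha hb ka kb hh hk mha mhb mka mkb ha0 hah hb0 hbh ka0 kak kb0 kbk
  change 0 ≤ (∑ η ∈ (E \ W).powerset, if 𝒱 η then h (S (η ∪ W)) * k (S (η ∪ W)) else 0)
      + (∑ η ∈ (E \ W).powerset, if 𝒱 η ∧ b ∈ C η u then h (S η) * k (S η) else 0)
      + ∑ η ∈ (E \ W).powerset, (if 𝒱 η ∧ b ∉ C η u then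
          (ha (C η u) - hb (C (E \ η) u)) * (ka (C η u) - kb (C (E \ η) u)) else 0) at hcontact
  -- (4) the supply dominates the three disjoint families: off {b ∈ C_u}; {η ∪ W}; the phantoms
  set A₀ : Finset (Finset ι) := E.powerset.filter (fun ω => b ∉ C ω u) with hA₀
  set A₁ : Finset (Finset ι) := ((E \ W).powerset.filter (fun η => 𝒱 η)).image (fun η => η ∪ W) with hA₁
  set A₂ : Finset (Finset ι) := (E \ W).powerset.filter (fun η => 𝒱 η ∧ b ∈ C η u) with hA₂
  have hWu : ∀ η, b ∈ C (η ∪ W) u := fun η => hCmono u Finset.subset_union_right hWub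
  have hinjW : ∀ η₁ ∈ (E \ W).powerset.filter (fun η => 𝒱 η), ∀ η₂ ∈ (E \ W).powerset.filter (fun η => 𝒱 η), η₁ ∪ W = η₂ ∪ W → η₁ = η₂ := by
    intro η₁ h₁ η₂ h₂ he
    have d1 : Disjoint η₁ W := Finset.disjoint_of_subset_left (Finset.mem_powerset.mp (Finset.mem_filter.mp h₁).1) Finset.sdiff_disjoint
    have d2 : Disjoint η₂ W := Finset.disjoint_of_subset_left (Finset.mem_powerset.mp (Finset.mem_filter.mp h₂).1) Finset.sdiff_disjoint
    rw [← Finset.union_sdiff_cancel_right d1, ← Finset.union_sdiff_cancel_right d2, he]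
  have hsum₁ : ∑ η ∈ (E \ W).powerset, (if 𝒱 η then h (S (η ∪ W)) * k (S (η ∪ W)) else 0) = ∑ ω ∈ A₁, h (S ω) * k (S ω) := by
    rw [← Finset.sum_filter, hA₁, Finset.sum_image (f := fun ω => h (S ω) * k (S ω)) hinjW]
  have hsum₂ : ∑ η ∈ (E \ W).powerset, (if 𝒱 η ∧ b ∈ C η u then h (S η) * k (S η) else 0) = ∑ ω ∈ A₂, h (S ω) * k (S ω) := by
    rw [← Finset.sum_filter]
  have hsum₀ : ∑ ω ∈ E.powerset, (if b ∉ C ω u then h (S ω) * k (S ω) else 0) = ∑ ω ∈ A₀, h (S ω) * k (S ω) := by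
    rw [← Finset.sum_filter]
  have hdisj₀₁ : Disjoint A₀ A₁ := by
    rw [Finset.disjoint_left]
    intro ω h0 h1
    rw [hA₀, Finset.mem_filter] at h0
    rw [hA₁, Finset.mem_image] at h1
    obtain ⟨η, _, rfl⟩ := h1
    exact h0.2 (hWu η)
  have hdisj₀₂ : Disjoint A₀ A₂ := by
    rw [Finset.disjoint_left]
    intro ω h0 h2
    rw [hA₀, Finset.mem_filter] at h0
    rw [hA₂, Finset.mem_filter] at h2
    exact h0.2 h2.2.2
  have hdisj₁₂ : Disjoint A₁ A₂ := by
    rw [Finset.disjoint_left]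
    intro ω h1 h2
    rw [hA₁, Finset.mem_image] at h1
    rw [hA₂, Finset.mem_filter, Finset.mem_powerset] at h2
    obtain ⟨η, _, rfl⟩ := h1
    obtain ⟨i, hi⟩ := hWne
    have hi' : i ∈ E \ W := h2.1 (Finset.mem_union_right η hi)
    exact (Finset.mem_sdiff.mp hi').2 hi
  have hsubU : A₀ ∪ A₁ ∪ A₂ ⊆ E.powerset := by
    intro ω hω
    rw [Finset.mem_union, Finset.mem_union] at hω
    rcases hω with (h0 | h1) | h2
    · exact (Finset.mem_filter.mp h0).1
    · rw [hA₁, Finset.mem_image] at h1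
      obtain ⟨η, hη, rfl⟩ := h1
      have hη' := Finset.mem_powerset.mp (Finset.mem_filter.mp hη).1
      exact Finset.mem_powerset.mpr (Finset.union_subset (le_trans hη' Finset.sdiff_subset) hWE)
    · have h2' := Finset.mem_powerset.mp (Finset.mem_filter.mp h2).1
      exact Finset.mem_powerset.mpr (le_trans h2' Finset.sdiff_subset)
  have hsplit_sup : (∑ ω ∈ A₀, h (S ω) * k (S ω)) + (∑ ω ∈ A₁, h (S ω) * k (S ω)) + (∑ ω ∈ A₂, h (S ω) * k (S ω))
      ≤ ∑ ω ∈ E.powerset, h (S ω) * k (S ω) := by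
    rw [← Finset.sum_union hdisj₀₁, ← Finset.sum_union (Finset.disjoint_union_left.mpr ⟨hdisj₀₂, hdisj₁₂⟩)]
    exact Finset.sum_le_sum_of_subset_of_nonneg hsubU (fun ω _ _ => hY0 ω)
  -- assemble
  rw [Finset.sum_add_distrib] at step
  rw [hsplit_anti, hD₂sum]
  rw [hsum₁, hsum₂] at hcontact
  rw [hsum₀] at lower
  linarith [hsplit_sup, step, lower, hcontact]

open Classical in
/-- **SKEW for internal degree `≤ 2` with a forced blue path (cycles through `u, b, v`).**  If no vertex other than `u, b` lies on three distinct edges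
of `E`, and `W ⊆ E` is a nonempty edge set joining `u` to `b` which is blue whenever `u` is blue-joined to `b` and `v` is not, then SKEW(E; u, v; b) holds at
all monotone levels: `0 ≤ Σ_ω h(C_u ω ∪ C_b ω)k(…) + Σ_{b ∉ C_u ω, v ∉ C_b(E∖ω)} (hᵃ(C_u ω) − hᵇ(C_b(E∖ω)))(kᵃ(C_u ω) − kᵇ(C_b(E∖ω)))`.  The map is the
pocket-free involution `R_A` of `…CoreClassDomPocketFree` (proper: it keeps `C_u`).  For a cycle through `u, b, v` take `W` = the `u–b` arc avoiding `v`.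
[cite: KozmaNitzan2024, Questions 8–9 (§5.5 p. 36) (context)] -/
theorem coreClass_skew_of_deg_le_two_path (ends : ι → Sym2 V) (E W : Finset ι) (u v b : V)
    (hdeg : ∀ x, x ≠ u → x ≠ b → ∀ i j l, i ∈ E → j ∈ E → l ∈ E → x ∈ ends i → x ∈ ends j → x ∈ ends l → i = j ∨ i = l ∨ j = l)
    (hWE : W ⊆ E) (hWne : W.Nonempty) (hWub : b ∈ openCluster (ends '' (↑W : Set ι)) u)
    (hArc : ∀ ω, ω ⊆ E → u ∈ openCluster (ends '' (↑(E \ ω) : Set ι)) b → v ∉ openCluster (ends '' (↑(E \ ω) : Set ι)) b → Disjoint W ω)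
    (h k ha hb ka kb : Set V → ℝ)
    (hh : Monotone h) (hk : Monotone k) (mha : Monotone ha) (mhb : Monotone hb) (mka : Monotone ka) (mkb : Monotone kb)
    (ha0 : ∀ X, 0 ≤ ha X) (hah : ∀ X, ha X ≤ h X) (hb0 : ∀ X, 0 ≤ hb X) (hbh : ∀ X, hb X ≤ h X)
    (ka0 : ∀ X, 0 ≤ ka X) (kak : ∀ X, ka X ≤ k X) (kb0 : ∀ X, 0 ≤ kb X) (kbk : ∀ X, kb X ≤ k X) :
    0 ≤ (∑ ω ∈ E.powerset,
        h (openCluster (ends '' (↑ω : Set ι)) u ∪ openCluster (ends '' (↑ω : Set ι)) b) *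
          k (openCluster (ends '' (↑ω : Set ι)) u ∪ openCluster (ends '' (↑ω : Set ι)) b))
      + ∑ ω ∈ E.powerset.filter (fun ω : Finset ι => b ∉ openCluster (ends '' (↑ω : Set ι)) u ∧ v ∉ openCluster (ends '' (↑(E \ ω) : Set ι)) b),
        (ha (openCluster (ends '' (↑ω : Set ι)) u) - hb (openCluster (ends '' (↑(E \ ω) : Set ι)) b)) *
          (ka (openCluster (ends '' (↑ω : Set ι)) u) - kb (openCluster (ends '' (↑(E \ ω) : Set ι)) b)) := by
  refine coreClass_skew_of_properDom_path ends E W u v b h k ha hb ka kb hh hk mha mhb mka mkb ha0 hah hb0 hbh ka0 kak kb0 kbk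
    (fun ω => ω ∆ E.filter (fun i => ∀ y, y ∈ ends i → y ∉ openCluster (ends '' (↑ω : Set ι)) u)) ?_ ?_ ?_ ?_ hWE hWne hWub hArc
  · -- stays inside `E`
    intro ω hω _ _ i hi
    rw [Finset.mem_symmDiff, Finset.mem_filter] at hi
    rcases hi with ⟨h1, _⟩ | ⟨h1, _⟩
    · exact hω h1
    · exact h1.1
  · -- coverage (pocket-free by internal degree ≤ 2)
    intro ω hω hbR hbB
    rw [openCluster_toggleOff_eq ends E ω u]
    have huB : u ∉ openCluster (ends '' (↑(E \ ω) : Set ι)) b := fun hx => hbB ((mem_openCluster_comm ends (E \ ω) u b).mpr hx)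
    intro y hy
    rcases hy with hy | hy
    · exact Or.inl hy
    · rcases pocketFree_of_deg_le_two ends E u b hdeg ω hω hbR huB hy with h1 | h1
      · exact Or.inl h1
      · exact Or.inr (openCluster_sdiff_off_subset_toggleOff ends E ω u b h1)
  · -- injectivity (involution)
    intro ω₁ ω₂ _ _ _ _ _ _ he
    have h1 := toggleOff_toggleOff ends E ω₁ u
    have h2 := toggleOff_toggleOff ends E ω₂ u
    beta_reduce at h1 h2
    rw [← h1, ← h2, he]
  · -- properness: `C_u` is kept
    intro ω _ hbR _
    rw [openCluster_toggleOff_eq ends E ω u]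
    exact hbR

end Coefficientwise

end Summit.CriticalPhenomena.PercolationContinuityZ3.Theorems
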